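import Summits.BirchSwinnertonDyer.BirchSwinnertonDyer.Theorems.KolyvaginDepthDoorDepthTableKuriharaExactRow
import Summits.BirchSwinnertonDyer.BirchSwinnertonDyer.Theorems.KolyvaginDepthDoorDepthTableKuriharaESide4
import Summits.BirchSwinnertonDyer.BirchSwinnertonDyer.Theorems.KolyvaginDepthDoorDepthTableRow718b1RankDischarged
import Summits.BirchSwinnertonDyer.Rank1Residual.Supersingular.CountPointsFast
import Summits.BirchSwinnertonDyer.Rank1Residual.Additive.X4ThreeKuriharaCertKernel
import Literature.NumberTheory.EllipticCurves.BSDSelmerPConverseSerreProofs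
import HarnessLib

/-!
# Route `KolyvaginDepthDoor`, crux `KolyvaginDepthSupplyKN` (stmt-BirchSwinnertonDyer-22820) —
# DEPTH TABLE v18, ROW `718b1` @ `(13, d_K = −7)`: the SOCKET for the fleet's twist record and the EXACT depth-one
# reading in Kurihara currency (twist model `T₀ = [1, 1, 0, -221, -307]` = `718b1^{(−7)}`, conductor `35182`)

Helper file of the lead prover of line `levelone` (kdd-p1 g22; `--supports stmt-BirchSwinnertonDyer-22820
--as helper`); it closes nothing and BSD is NOT proved by it. Same template as `…KuriharaSocket709a1` at `p = 13`.

The E-side of this row is built HERE at `p = 13` (§0, g21's pattern: `C718b1.sha_inf_torsionBy_eq_bot_of_kuriharaClaim_13` —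
`Ш(718b1)[13] = 0` from the record `cert_718b1` @ `(13, 911·1847)`, claim `hδE`; v17's E-side prime `7` divides `d_K = −7`); every side condition of `E = 718b1` and of the minimal twist model
`T₀` at `p = 13` is a kernel theorem of the lineage or of this file (`goodOrdinary_13`, `hasSurjectiveModNGaloisRep_13` + Serre,
`nonAnomalous_13`, `kodairaNeron_of_five_le 13`, `spadeOne_of_five_le 13`, `heegner_neg7`, `not_hasCM`,
`Rank2Observatory.C718b1.mordellWeilRank_eq_two`; `minTwist7_isElliptic/_isGloballyMinimal/_smul_eq/_card_13`, Kodaira–Néron of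
`T₀` at `13`). What is OWED is one datum on `T₀`:

* `minTwist7_nonAnomalous_13` — `a_13(T₀) = 2 ≢ 1 (mod 13)` (kernel: `#T̃₀(𝔽_13) = 12`). `minTwist7_card_13` — `#T̃₀(𝔽_13) = 12` (kernel); and the E-SIDE at `13` (§0:
  `card_13`, `card_911`, `card_1847`, `goodOrdinary_13`, `hasSurjectiveModNGaloisRep_13`, `nonAnomalous_13`, `isCyclicKolyvaginLevel_13_1682617`,
  `sha_inf_torsionBy_eq_bot_of_kuriharaClaim_13` — `Ш(718b1)[13] = 0` from the tree record `cert_718b1` @ `(13, 911·1847)`, g21's pattern;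
  the `p = 7` E-side of v17 cannot serve this row since `7 ∣ d_K = −7`).
* `cruxBody_of_twistKuriharaClaim_13_neg7` — **THE SOCKET**: for every `K` with `d_K = −7`, IF some cyclic Kolyvagin level
  `m` of `(T₀, 13)` with `ν(m) ≤ 2` carries a unit mod-`13` Kurihara number (the CLAIM of a future tree record `cert_<T₀>` at
  `(13, m)`, hypothesis `hδT`), THEN the clause of `KolyvaginDepthSupplyKN` holds at `W = 718b1` verbatim (v17's
  `cruxBody_of_kuriharaClaims_spade` with every other input discharged; Kim Thm. 1.11, modularity, Mazur Cor. 4.1, W. Zhang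
  L8.4 (1)/9.1 BY NAME).
* `kolyvaginPrime_iff_twistKuriharaBit_13_neg7` — **THE EXACT DEPTH-ONE READING**: granted the E-side claim `hδE`, «∃ frame,
  Kolyvagin PRIME `ℓ`, datum with `c_1(ℓ) ≠ 0`» ⟺ «for every admissible datum of `T₀`, some cyclic Kolyvagin level of `(T₀, 13)`
  of depth `≤ 1` carries a unit mod-`13` Kurihara number» — g14's generic rank-two row
  `kolyvaginClass_prime_ne_zero_iff_shaTrivial_twistSelmer_of_rank_two_of_lemma84` («bit ⟺ Ш(E)[13] = 0 ∧ #Sel_13(E^{(−7)}) ≤ 13»,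
  (γ) + W. Zhang by name; rank `= 2` by kernel 2-descent) ∘ v18's twist IFF (Sakamoto Thm. 1.2/1.5 + Kim Thm. 1.11 by name).
  The fleet's datum for this row is EXACTLY one residue `δ̃_ℓ(T₀) mod 13` at a cyclic Kolyvagin prime `ℓ` of `(T₀, 13)`
  (`ℓ ∤ 13·35182`, `ℓ ≡ 1 (mod 13)`, `a_ℓ(T₀) ≡ 2 (mod 13)`, `169 ∤ #T̃₀(𝔽_ℓ)`).

CONDITIONAL on the named facts displayed (`hKim`, `hSak1`, `hSak2`, `hnf`, `hMaz`, `h372`, `h84`) and on the record claims;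
per curve; nothing class-wide; BSD is NOT proved by any of this.

References: [Sakamoto2022pSelmer] Thm. 1.2, Thm. 1.5; [Kim2022StructureSelmer] Thm. 1.11, §1.2.2; [WZhang2014] Lemma 8.4 (1),
Thm. 9.1; [GrossLMS1991] Prop. 3.7 (2); [Mazur1978] Cor. 4.1; [CremonaAlgorithms1997] Table 1 (718b1); [SilvermanAEC2009]
VII.3.1, VIII.8, X.4.2, X.5 Cor. 5.4.
-/

set_option linter.dupNamespace false

noncomputable section

open scoped Classical NumberField

namespace Summit.BirchSwinnertonDyer.BirchSwinnertonDyer.Theorems.KolyvaginDepthDoor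

open Literature.NumberTheory.EllipticCurves Literature.NumberTheory.EllipticCurves.ModularForms
  WeierstrassCurve NumberField IsDedekindDomain
open Summit.BirchSwinnertonDyer.BirchSwinnertonDyer.Theorems
open Summit.BirchSwinnertonDyer.BirchSwinnertonDyer.Rank2Observatory
open Summit.BirchSwinnertonDyer.BirchSwinnertonDyer.Rank1Residual (IntModel.frobeniusTrace_eq)
open Summit.BirchSwinnertonDyer.Rank1Residual.Additive
open Summit.BirchSwinnertonDyer.Rank1Residual.Supersingular (natCard_point_eq_of_countPoints countPoints_eq_of_fast)

namespace C718b1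

/-! ## §0 The E-side at `p = 13` (record `cert_718b1` @ `(13, 911·1847)`, `δ̃ ≡ 8`… its CLAIM `hδE`) -/

/-- `#Ẽ(𝔽_13) = 16` for `718b1` (`a_13 = -2`: good ordinary, non-anomalous at `13`), kernel-decided (`countPointsFast`).
[cite: CremonaAlgorithms1997, Table 1 (718b1)] -/
theorem card_13 :
    Nat.card (((⟨1, 0, 1, -5, 0⟩ : WeierstrassCurve ℤ).map (Int.castRingHom (ZMod 13))).toAffine.Point) = 16 :=
  haveI : Fact (Nat.Prime 13) := ⟨by norm_num⟩
  natCard_point_eq_of_countPoints 1 0 1 (-5) 0 13 (by norm_num) (by decide +kernel) (n := 16)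
    (countPoints_eq_of_fast (by decide +kernel))

/-- `#Ẽ(𝔽_911) = 910` for `718b1` (`911 ≡ 1`, `a_911 = 2 ≡ 2 (mod 13)`, `13² ∤ 910`), kernel-decided (`countPointsFast`).
[cite: CremonaAlgorithms1997, Table 1 (718b1)] -/
theorem card_911 :
    Nat.card (((⟨1, 0, 1, -5, 0⟩ : WeierstrassCurve ℤ).map (Int.castRingHom (ZMod 911))).toAffine.Point) = 910 :=
  haveI : Fact (Nat.Prime 911) := ⟨by norm_num⟩
  natCard_point_eq_of_countPoints 1 0 1 (-5) 0 911 (by norm_num) (by decide +kernel) (n := 910)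
    (countPoints_eq_of_fast (by decide +kernel))

/-- `#Ẽ(𝔽_1847) = 1911` for `718b1` (`1847 ≡ 1`, `a_1847 = -63 ≡ 2 (mod 13)`, `13² ∤ 1911`), kernel-decided (`countPointsFast`).
[cite: CremonaAlgorithms1997, Table 1 (718b1)] -/
theorem card_1847 :
    Nat.card (((⟨1, 0, 1, -5, 0⟩ : WeierstrassCurve ℤ).map (Int.castRingHom (ZMod 1847))).toAffine.Point) = 1911 :=
  haveI : Fact (Nat.Prime 1847) := ⟨by norm_num⟩
  natCard_point_eq_of_countPoints 1 0 1 (-5) 0 1847 (by norm_num) (by decide +kernel) (n := 1911)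
    (countPoints_eq_of_fast (by decide +kernel))

/-- **`13` is good ordinary for `718b1`** (`13 ∤ Δ`, `a_13 = -2`). [cite: CremonaAlgorithms1997, Table 1 (718b1)] -/
theorem goodOrdinary_13 :
    haveI := Fact.mk (by norm_num : Nat.Prime 13); haveI := isGloballyMinimal_c718b1;
    ((⟨1, 0, 1, -5, 0⟩ : WeierstrassCurve ℤ).map (Int.castRingHom ℚ)).HasGoodReductionAtPrime 13 ∧
      ¬ ((13 : ℕ) : ℤ) ∣ ((⟨1, 0, 1, -5, 0⟩ : WeierstrassCurve ℤ).map (Int.castRingHom ℚ)).frobeniusTrace 13 := by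
  haveI := Fact.mk (by norm_num : Nat.Prime 13)
  haveI := isElliptic_c718b1
  haveI := isGloballyMinimal_c718b1
  exact goodOrdinary_of_intModel_certificate intModel 13 (by decide +kernel) (n := 16) card_13 (by decide +kernel)

/-- **`ρ̄_{E,13}` is surjective for `718b1`**: semistable (`gcd(c₄, Δ) = 1`) and `X² − (-2)X + 3` (`a_3 = -2`) has no root
mod `13` (its discriminant `−8 ≡ 5` is a non-square mod `13`; Mazur Prop. 6.3 (1) ⟹ `E[13]` irreducible; Serre Prop. 21 ⟹
onto). [cite: Serre1972, §5.4 Prop. 21] [cite: Mazur1978, §6 Prop. 6.3 (1)] -/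
theorem hasSurjectiveModNGaloisRep_13 :
    haveI := isElliptic_c718b1;
    ((⟨1, 0, 1, -5, 0⟩ : WeierstrassCurve ℤ).map (Int.castRingHom ℚ)).HasSurjectiveModNGaloisRep (13 : ℕ) := by
  have hn : ∀ t : ZMod 13, t ^ 2 - (((3 : ℕ) : ℤ) + 1 - (6 : ℕ) : ℤ) * t + ((3 : ℕ) : ZMod 13) ≠ 0 := by
    decide +kernel
  haveI := Fact.mk (by norm_num : Nat.Prime 13); haveI := Fact.mk (by norm_num : Nat.Prime 3)
  haveI := isElliptic_c718b1; haveI := isGloballyMinimal_c718b1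
  exact hasSurjectiveModNGaloisRep_of_intModel_certificate intModel
    (by rw [Int.isCoprime_iff_gcd_eq_one]; decide +kernel) 13 3 (by norm_num) (by decide +kernel)
    (n := 6) card_3 hn

/-- **`13` is non-anomalous for `718b1`**: `a_13 − 1 = -3`. [cite: SilvermanAEC2009, VII.3 Prop. 3.1] -/
theorem nonAnomalous_13 :
    haveI := isGloballyMinimal_c718b1; haveI := Fact.mk (by norm_num : Nat.Prime 13);
    ¬ ((13 : ℕ) : ℤ) ∣ ((⟨1, 0, 1, -5, 0⟩ : WeierstrassCurve ℤ).map (Int.castRingHom ℚ)).frobeniusTrace 13 - 1 := by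
  haveI := isElliptic_c718b1; haveI := isGloballyMinimal_c718b1; haveI := Fact.mk (by norm_num : Nat.Prime 13)
  rw [IntModel.frobeniusTrace_eq intModel card_13]
  decide

/-- **`1682617 = 911·1847` is a cyclic Kolyvagin level for `(718b1, 13)`** — the level of the tree record `cert_718b1` at
`p = 13` (`ℓ ≡ 1`, `a_ℓ ≡ 2 (mod 13)`, `169 ∤ #Ẽ(𝔽_ℓ)`). [cite: Kim2022StructureSelmer, §1.2.2 (PDF p. 5)] -/
theorem isCyclicKolyvaginLevel_13_1682617 :
    haveI := isGloballyMinimal_c718b1; haveI := Fact.mk (by norm_num : Nat.Prime 13);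
    IsCyclicKolyvaginLevel ((⟨1, 0, 1, -5, 0⟩ : WeierstrassCurve ℤ).map (Int.castRingHom ℚ)) 13 1682617 := by
  haveI := isElliptic_c718b1
  haveI := isGloballyMinimal_c718b1
  haveI := Fact.mk (by norm_num : Nat.Prime 13)
  haveI : Fact (Nat.Prime 911) := ⟨by norm_num⟩
  haveI : Fact (Nat.Prime 1847) := ⟨by norm_num⟩
  have h₁ : Kato.IsKolyvaginPrime ((⟨1, 0, 1, -5, 0⟩ : WeierstrassCurve ℤ).map (Int.castRingHom ℚ)) 13 1 911 :=
    isKolyvaginPrime_of_intModel_of_card intModel 13 1 911 (by norm_num) (by decide +kernel) (by decide) card_911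
      (by norm_num)
  have h₂ : Kato.IsKolyvaginPrime ((⟨1, 0, 1, -5, 0⟩ : WeierstrassCurve ℤ).map (Int.castRingHom ℚ)) 13 1 1847 :=
    isKolyvaginPrime_of_intModel_of_card intModel 13 1 1847 (by norm_num) (by decide +kernel) (by decide) card_1847
      (by norm_num)
  refine ⟨by simpa using isKolyvaginProduct_mul h₁ h₂ (by norm_num), fun ℓ hℓ hdvd ↦ ?_⟩
  rw [show (1682617 : ℕ) = 911 * 1847 from rfl] at hdvd
  rcases (Nat.Prime.dvd_mul hℓ.out).mp hdvd with h | h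
  · obtain rfl := (Nat.prime_dvd_prime_iff_eq hℓ.out (by norm_num)).mp h
    exact card_torsion_le_of_intModel_of_card intModel 13 911 card_911 (by norm_num)
  · obtain rfl := (Nat.prime_dvd_prime_iff_eq hℓ.out (by norm_num)).mp h
    exact card_torsion_le_of_intModel_of_card intModel 13 1847 card_1847 (by norm_num)

/-- **`Ш(718b1/ℚ)[13] = 0` FROM THE TREE RECORD `cert_718b1` @ `(13, 911·1847)`** (g21's E-side pattern at a new prime):
granted Kim Thm. 1.11 (`hKim`), modularity (`hnf`), Mazur Cor. 4.1 (`hMaz`) BY NAME and the record's CLAIM `hδ`,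
`#Sel_13(E/ℚ) ≤ 13² = 13^rank` and so `Ш(E/ℚ)[13] = 0`. CONDITIONAL on the three named facts and the claim; per curve;
BSD is not proved by it. [cite: Kim2022StructureSelmer, Thm. 1.11 (PDF p. 8)] [cite: Mazur1978, Cor. 4.1] [cite: CremonaAlgorithms1997, Table 1 (718b1)] -/
theorem sha_inf_torsionBy_eq_bot_of_kuriharaClaim_13
    (hKim : Kim2022_card_selmerGroup_le_pow_of_kuriharaNumber_ne_zero)
    (hnf : exists_isNewformOf) (hMaz : mazur_not_dvd_maninConstant_of_odd)
    (hδ : haveI := isElliptic_c718b1; haveI := isGloballyMinimal_c718b1;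
      haveI : NeZero (((⟨1, 0, 1, -5, 0⟩ : WeierstrassCurve ℤ).map (Int.castRingHom ℚ)).conductorNorm ℤ) := neZero_conductorNorm_of_isElliptic _;
      haveI := Fact.mk (by norm_num : Nat.Prime 13);
      ∀ (D : ModularParametrizationData ((⟨1, 0, 1, -5, 0⟩ : WeierstrassCurve ℤ).map (Int.castRingHom ℚ)) (((⟨1, 0, 1, -5, 0⟩ : WeierstrassCurve ℤ).map (Int.castRingHom ℚ)).conductorNorm ℤ)), ¬ ((13 : ℕ) : ℤ) ∣ D.maninConstant →
        (∃ u : ℚ, ‖(u : ℚ_[13])‖ = 1 ∧ ((⟨1, 0, 1, -5, 0⟩ : WeierstrassCurve ℤ).map (Int.castRingHom ℚ)).realPeriodRat = u * plusPeriod D.f) →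
        ∃ ψ : (ℓ : ℕ) → (ZMod ℓ)ˣ →* Multiplicative (ZMod 13),
          (∀ ℓ ∈ (1682617 : ℕ).primeFactors, Function.Surjective (ψ ℓ)) ∧ kuriharaNumber D.f 13 1682617 ψ ≠ 0) :
    haveI := isElliptic_c718b1; haveI := isGloballyMinimal_c718b1; haveI := Fact.mk (by norm_num : Nat.Prime 13);
    (((⟨1, 0, 1, -5, 0⟩ : WeierstrassCurve ℤ).map (Int.castRingHom ℚ)).sha ⊓ AddSubgroup.torsionBy ((⟨1, 0, 1, -5, 0⟩ : WeierstrassCurve ℤ).map (Int.castRingHom ℚ)).galH1 ((13 : ℕ) : ℤ) : AddSubgroup _) = ⊥ := by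
  haveI := isElliptic_c718b1
  haveI := isGloballyMinimal_c718b1
  haveI iNZ : NeZero (((⟨1, 0, 1, -5, 0⟩ : WeierstrassCurve ℤ).map (Int.castRingHom ℚ)).conductorNorm ℤ) := neZero_conductorNorm_of_isElliptic _
  haveI := Fact.mk (by norm_num : Nat.Prime 13)
  haveI : NeZero (1682617 : ℕ) := ⟨by norm_num⟩
  have hν : (1682617 : ℕ).primeFactors.card ≤ ((⟨1, 0, 1, -5, 0⟩ : WeierstrassCurve ℤ).map (Int.castRingHom ℚ)).mordellWeilRank := by
    refine le_trans (le_of_eq ?_) KernelCerts002.C718b1.two_le_rank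
    rw [show (1682617 : ℕ) = 911 * 1847 from rfl, Nat.primeFactors_mul (by norm_num) (by norm_num),
      Nat.Prime.primeFactors (by norm_num), Nat.Prime.primeFactors (by norm_num)]
    decide
  exact sha_inf_torsionBy_eq_bot_of_kuriharaClaim hKim hnf hMaz _ 13 (by norm_num) goodOrdinary_13.1 goodOrdinary_13.2
    hasSurjectiveModNGaloisRep_13 nonAnomalous_13 (kodairaNeron_of_five_le 13 (by norm_num)) 1682617
    isCyclicKolyvaginLevel_13_1682617 hν hδ

/-! ## §1 The twist side at `13` and the socket -/

/-- `#T̃₀(𝔽_13) = 12` for `T₀ = [1, 1, 0, -221, -307]`, i.e. `a_13(T₀) = 2` (`= a_13(E)·(−7/13) = (−2)·(−1)`; kernel-decided,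
`ℕ`-arithmetic Euler count). [cite: SilvermanAEC2009, V.2] -/
theorem minTwist7_card_13 :
    Nat.card (((⟨1, 1, 0, -221, -307⟩ : WeierstrassCurve ℤ).map (Int.castRingHom (ZMod 13))).toAffine.Point) = 12 := by
  rw [PointCountNat.natCard_point_map_eq (hℓ := ⟨by norm_num⟩) (by norm_num) 1 1 0 (-221) (-307)
    (by decide +kernel)]
  decide +kernel

/-- **`13` is non-anomalous for the twist model `T₀ = [1, 1, 0, -221, -307]`**: `#T̃₀(𝔽_13) = 12`, `a_13(T₀) = 2`,
`13 ∤ a_13(T₀) − 1` (Sakamoto's hypothesis (c) / Kim's (iii) for `T₀`). [cite: SilvermanAEC2009, VII.3 Prop. 3.1] -/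
theorem minTwist7_nonAnomalous_13 :
    haveI := minTwist7_isGloballyMinimal; haveI := Fact.mk (by norm_num : Nat.Prime 13);
    ¬ ((13 : ℕ) : ℤ) ∣ ((⟨1, 1, 0, -221, -307⟩ : WeierstrassCurve ℤ).map (Int.castRingHom ℚ)).frobeniusTrace 13 - 1 := by
  haveI := minTwist7_isElliptic
  haveI := minTwist7_isGloballyMinimal
  haveI := Fact.mk (by norm_num : Nat.Prime 13)
  rw [IntModel.frobeniusTrace_eq minTwist7_intModel minTwist7_card_13]
  decide

/-- **THE SOCKET for row `718b1` @ `(13, −7)`: the clause of `KolyvaginDepthSupplyKN` at `W = 718b1` from the EXISTING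
E-side record claim and ONE FUTURE twist record claim.** For every imaginary quadratic `K` with `d_K = −7`: granted
Kim Thm. 1.11 (`hKim`), modularity (`hnf`), Mazur Cor. 4.1 (`hMaz`), W. Zhang L8.4 (1)/9.1 (`h84`) BY NAME, the claim
`hδE` of the tree record `cert_718b1` @ `(7, 1682617 = 911·1847)`, and — THE DATUM OWED — a cyclic Kolyvagin level `m` of
`(T₀, 13)` (`hm`) of depth `ν(m) ≤ 2` (`hμ`) whose claim `hδT` holds, the crux's clause holds at `718b1` VERBATIM. CONDITIONAL
on the four named facts and the two claims; per curve; BSD is not proved by it.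
[cite: Kim2022StructureSelmer, Thm. 1.11 (PDF p. 8)] [cite: WZhang2014, Lemma 8.4 (1) (p. 236), Thm. 9.1 (p. 240)]
[cite: Mazur1978, Cor. 4.1] [cite: CremonaAlgorithms1997, Table 1 (718b1)] -/
theorem cruxBody_of_twistKuriharaClaim_13_neg7
    (hKim : Kim2022_card_selmerGroup_le_pow_of_kuriharaNumber_ne_zero)
    (hnf : exists_isNewformOf) (hMaz : mazur_not_dvd_maninConstant_of_odd)
    (h84 : Literature.NumberTheory.EllipticCurves.WZhang2014_lemma84_exists_minimal_kolyvaginClass_one_selmerCard)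
    (K : Type) [Field K] [NumberField K] (hK : IsImaginaryQuadratic K) (hD : NumberField.discr K = -7)
    (hδE : haveI := isElliptic_c718b1; haveI := isGloballyMinimal_c718b1;
      haveI : NeZero (((⟨1, 0, 1, -5, 0⟩ : WeierstrassCurve ℤ).map (Int.castRingHom ℚ)).conductorNorm ℤ) := neZero_conductorNorm_of_isElliptic _;
      haveI := Fact.mk (by norm_num : Nat.Prime 13);
      ∀ (D : ModularParametrizationData ((⟨1, 0, 1, -5, 0⟩ : WeierstrassCurve ℤ).map (Int.castRingHom ℚ)) (((⟨1, 0, 1, -5, 0⟩ : WeierstrassCurve ℤ).map (Int.castRingHom ℚ)).conductorNorm ℤ)), ¬ ((13 : ℕ) : ℤ) ∣ D.maninConstant →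
        (∃ u : ℚ, ‖(u : ℚ_[13])‖ = 1 ∧ ((⟨1, 0, 1, -5, 0⟩ : WeierstrassCurve ℤ).map (Int.castRingHom ℚ)).realPeriodRat = u * plusPeriod D.f) →
        ∃ ψ : (ℓ : ℕ) → (ZMod ℓ)ˣ →* Multiplicative (ZMod 13),
          (∀ ℓ ∈ (1682617 : ℕ).primeFactors, Function.Surjective (ψ ℓ)) ∧ kuriharaNumber D.f 13 1682617 ψ ≠ 0)
    (m : ℕ) [NeZero m]
    (hm : haveI := minTwist7_isGloballyMinimal;
      IsCyclicKolyvaginLevel ((⟨1, 1, 0, -221, -307⟩ : WeierstrassCurve ℤ).map (Int.castRingHom ℚ)) 13 m)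
    (hμ : m.primeFactors.card ≤ 2)
    (hδT : haveI := minTwist7_isElliptic; haveI := minTwist7_isGloballyMinimal;
      haveI : NeZero (((⟨1, 1, 0, -221, -307⟩ : WeierstrassCurve ℤ).map (Int.castRingHom ℚ)).conductorNorm ℤ) :=
        neZero_conductorNorm_of_isElliptic _;
      haveI := Fact.mk (by norm_num : Nat.Prime 13);
      ∀ (D : ModularParametrizationData ((⟨1, 1, 0, -221, -307⟩ : WeierstrassCurve ℤ).map (Int.castRingHom ℚ))
          (((⟨1, 1, 0, -221, -307⟩ : WeierstrassCurve ℤ).map (Int.castRingHom ℚ)).conductorNorm ℤ)),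
        ¬ ((13 : ℕ) : ℤ) ∣ D.maninConstant →
        (∃ u : ℚ, ‖(u : ℚ_[13])‖ = 1 ∧
          ((⟨1, 1, 0, -221, -307⟩ : WeierstrassCurve ℤ).map (Int.castRingHom ℚ)).realPeriodRat = u * plusPeriod D.f) →
        ∃ ψ : (ℓ : ℕ) → (ZMod ℓ)ˣ →* Multiplicative (ZMod 13),
          (∀ ℓ ∈ m.primeFactors, Function.Surjective (ψ ℓ)) ∧ kuriharaNumber D.f 13 m ψ ≠ 0) :
    haveI := isElliptic_c718b1; haveI := isGloballyMinimal_c718b1;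
    ∃ (p : ℕ) (hp : Fact p.Prime), 5 ≤ p ∧ ((⟨1, 0, 1, -5, 0⟩ : WeierstrassCurve ℤ).map (Int.castRingHom ℚ)).HasGoodReductionAtPrime p ∧
      ¬ (p : ℤ) ∣ ((⟨1, 0, 1, -5, 0⟩ : WeierstrassCurve ℤ).map (Int.castRingHom ℚ)).frobeniusTrace p ∧
      (∀ n : ℕ, ((⟨1, 0, 1, -5, 0⟩ : WeierstrassCurve ℤ).map (Int.castRingHom ℚ)).HasSurjectiveModNGaloisRep (p ^ n : ℕ)) ∧
      (∀ v : HeightOneSpectrum (𝓞 ℚ), ((⟨1, 0, 1, -5, 0⟩ : WeierstrassCurve ℤ).map (Int.castRingHom ℚ)).HasMultiplicativeReductionAt v →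
        ¬ p ∣ ((⟨1, 0, 1, -5, 0⟩ : WeierstrassCurve ℤ).map (Int.castRingHom ℚ)).ordMinimalDiscriminant v) ∧
      ∃ (K : Type) (_ : Field K) (_ : NumberField K), IsImaginaryQuadratic K ∧
        NumberField.discr K ≠ -3 ∧ NumberField.discr K ≠ -4 ∧
        ∃ (_ : NeZero (((⟨1, 0, 1, -5, 0⟩ : WeierstrassCurve ℤ).map (Int.castRingHom ℚ)).conductorNorm ℤ)),
          SatisfiesHeegnerHypothesis (((⟨1, 0, 1, -5, 0⟩ : WeierstrassCurve ℤ).map (Int.castRingHom ℚ)).conductorNorm ℤ) K ∧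
        ∃ (Dt : ModularParametrizationData ((⟨1, 0, 1, -5, 0⟩ : WeierstrassCurve ℤ).map (Int.castRingHom ℚ)) (((⟨1, 0, 1, -5, 0⟩ : WeierstrassCurve ℤ).map (Int.castRingHom ℚ)).conductorNorm ℤ))
          (β : ℤ) (ι : K →+* ℂ) (n₁ : ℕ) (d : KolyvaginHeegnerData Dt β ι n₁), Squarefree n₁ ∧
          (∀ q ∈ n₁.primeFactors, Zhang2014.IsKolyvaginPrime (((⟨1, 0, 1, -5, 0⟩ : WeierstrassCurve ℤ).map (Int.castRingHom ℚ)).conductorNorm ℤ)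
            ((⟨1, 0, 1, -5, 0⟩ : WeierstrassCurve ℤ).map (Int.castRingHom ℚ)) K p q) ∧
          d.kolyvaginClass hp.out 1 ≠ 0 ∧
          (n₁.primeFactors.card + 1 ≤ ((⟨1, 0, 1, -5, 0⟩ : WeierstrassCurve ℤ).map (Int.castRingHom ℚ)).mordellWeilRank ∨
            (n₁.primeFactors.card ≤ ((⟨1, 0, 1, -5, 0⟩ : WeierstrassCurve ℤ).map (Int.castRingHom ℚ)).mordellWeilRank ∧
              n₁.primeFactors.card + 1 ≤ (((⟨1, 0, 1, -5, 0⟩ : WeierstrassCurve ℤ).map (Int.castRingHom ℚ)).quadraticTwist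
                (NumberField.discr K : ℚ)).mordellWeilRank)) := by
  haveI := isElliptic_c718b1
  haveI := isGloballyMinimal_c718b1
  haveI iNZ : NeZero (((⟨1, 0, 1, -5, 0⟩ : WeierstrassCurve ℤ).map (Int.castRingHom ℚ)).conductorNorm ℤ) :=
    neZero_conductorNorm_of_isElliptic _
  haveI := minTwist7_isElliptic
  haveI := minTwist7_isGloballyMinimal
  haveI iNZT : NeZero (((⟨1, 1, 0, -221, -307⟩ : WeierstrassCurve ℤ).map (Int.castRingHom ℚ)).conductorNorm ℤ) :=
    neZero_conductorNorm_of_isElliptic _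
  haveI iP := Fact.mk (by norm_num : Nat.Prime 13)
  haveI : NeZero (1682617 : ℕ) := ⟨by norm_num⟩
  have hsp := spadeOne_of_five_le 13 (by norm_num)
  have hS2 : ¬ Squarefree (((⟨1, 0, 1, -5, 0⟩ : WeierstrassCurve ℤ).map (Int.castRingHom ℚ)).conductorNorm ℤ) →
      (∃ (ℓ : ℕ) (_ : Fact ℓ.Prime), ((⟨1, 0, 1, -5, 0⟩ : WeierstrassCurve ℤ).map (Int.castRingHom ℚ)).HasMultiplicativeReductionAtPrime ℓ ∧
          ¬ 13 ∣ padicValInt ℓ ((⟨1, 0, 1, -5, 0⟩ : WeierstrassCurve ℤ).map (Int.castRingHom ℚ)).minimalDiscriminantInt) ∧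
        ∃ (ℓ₁ ℓ₂ : ℕ) (_ : Fact ℓ₁.Prime) (_ : Fact ℓ₂.Prime), ℓ₁ ≠ ℓ₂ ∧
          ((⟨1, 0, 1, -5, 0⟩ : WeierstrassCurve ℤ).map (Int.castRingHom ℚ)).HasMultiplicativeReductionAtPrime ℓ₁ ∧
          ((⟨1, 0, 1, -5, 0⟩ : WeierstrassCurve ℤ).map (Int.castRingHom ℚ)).HasMultiplicativeReductionAtPrime ℓ₂ :=
    fun hns ↦ absurd ((((⟨1, 0, 1, -5, 0⟩ : WeierstrassCurve ℤ).map (Int.castRingHom ℚ))).isSemistable_iff_squarefree_conductorNorm.mp hsp.2) hns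
  have hH := satisfiesHeegnerHypothesis_conductorNorm_of_intModel intModel K hK.1 hD heegner_neg7
  have hD3 : NumberField.discr K ≠ -3 := by rw [hD]; norm_num
  have hD4 : NumberField.discr K ≠ -4 := by rw [hD]; norm_num
  have hpD : ¬ (((13 : ℕ) : ℤ) ∣ NumberField.discr K) := by rw [hD]; decide
  have hsur : ((⟨1, 0, 1, -5, 0⟩ : WeierstrassCurve ℤ).map (Int.castRingHom ℚ)).HasSurjectiveModNGaloisRep ((13 : ℕ) : ℤ) := by
    simpa using hasSurjectiveModNGaloisRep_13
  have htower : ∀ k : ℕ, ((⟨1, 0, 1, -5, 0⟩ : WeierstrassCurve ℤ).map (Int.castRingHom ℚ)).HasSurjectiveModNGaloisRep ((13 : ℕ) ^ k : ℕ) :=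
    serre_hasSurjectiveModNGaloisRep_pow_holds _ 13 (by norm_num) hsur
  have hC : (⟨1, (-1 : ℚ), -((1 : ℚ) / 2), (1 : ℚ) / 2⟩ : WeierstrassCurve.VariableChange ℚ) •
      ((⟨1, 1, 0, -221, -307⟩ : WeierstrassCurve ℤ).map (Int.castRingHom ℚ)) =
      ((⟨1, 0, 1, -5, 0⟩ : WeierstrassCurve ℤ).map (Int.castRingHom ℚ)).quadraticTwist (NumberField.discr K : ℚ) := by
    rw [hD]; push_cast; exact minTwist7_smul_eq
  have hrank : 2 ≤ ((⟨1, 0, 1, -5, 0⟩ : WeierstrassCurve ℤ).map (Int.castRingHom ℚ)).mordellWeilRank :=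
    KernelCerts002.C718b1.two_le_rank
  have hr2 := Summit.BirchSwinnertonDyer.BirchSwinnertonDyer.Rank2Observatory.C718b1.mordellWeilRank_eq_two
  have hν' : (1682617 : ℕ).primeFactors.card ≤ ((⟨1, 0, 1, -5, 0⟩ : WeierstrassCurve ℤ).map (Int.castRingHom ℚ)).mordellWeilRank := by
    rw [hr2, show (1682617 : ℕ) = 911 * 1847 from rfl, Nat.primeFactors_mul (by norm_num) (by norm_num),
      Nat.Prime.primeFactors (by norm_num), Nat.Prime.primeFactors (by norm_num)]
    decide
  have hμ' : m.primeFactors.card ≤ ((⟨1, 0, 1, -5, 0⟩ : WeierstrassCurve ℤ).map (Int.castRingHom ℚ)).mordellWeilRank := by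
    rw [hr2]; exact hμ
  exact cruxBody_of_kuriharaClaims_spade hKim hnf hMaz h84 _ hrank 13 (by norm_num) goodOrdinary_13.1 goodOrdinary_13.2 htower
    (kodairaNeron_of_five_le 13 (by norm_num)) nonAnomalous_13 hsp.1 hS2 K hK hD3 hD4 hpD hH 1682617 isCyclicKolyvaginLevel_13_1682617 hν' hδE
    ((⟨1, 1, 0, -221, -307⟩ : WeierstrassCurve ℤ).map (Int.castRingHom ℚ)) _ hC minTwist7_nonAnomalous_13
    (minTwist7_kodairaNeron_of_five_le 13 (by norm_num)) m hm hμ' hδT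

/-- **THE EXACT DEPTH-ONE READING of row `718b1` @ `(13, −7)` in Kurihara currency.** Granted the E-side claim `hδE`
(record `cert_718b1` @ `(13, 911·1847)`; with Kim Thm. 1.11 it gives `Ш(718b1)[13] = 0`) and the named facts displayed:
for every `K` with `d_K = −7`, «some frame, some Kolyvagin PRIME `ℓ`, some Kolyvagin–Heegner datum of conductor `ℓ` with
`c_1(ℓ) ≠ 0`» holds IF AND ONLY IF «for every datum `D` of `T₀ = [1, 1, 0, -221, -307]` at level `N_{T₀}` with `13 ∤ c_D` and the
period transfer, some cyclic Kolyvagin level `m` of `(T₀, 13)` with `ν(m) ≤ 1` carries a unit mod-`13` Kurihara number» —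
g14's generic rank-two row (`kolyvaginClass_prime_ne_zero_iff_shaTrivial_twistSelmer_of_rank_two_of_lemma84`, (γ) + W. Zhang
by name, rank `= 2` by kernel 2-descent) ∘ v18's twist IFF (Sakamoto Thm. 1.2/1.5 + Kim Thm. 1.11 + modularity + Mazur by
name). So the row's missing datum is EXACTLY one residue `δ̃_ℓ(T₀) mod 13` at a cyclic Kolyvagin prime `ℓ` of `(T₀, 13)`
(conductor `N_{T₀} = 35182`, inside the kurihara fleet's range). CONDITIONAL on the seven named facts and the claim `hδE`;
per curve; BSD is not proved by it. [cite: Sakamoto2022pSelmer, Thm. 1.2, Thm. 1.5] [cite: Kim2022StructureSelmer, Thm. 1.11]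
[cite: WZhang2014, Lemma 8.4 (1) (p. 236)] [cite: GrossLMS1991, Prop. 3.7 (2), §5 (5.1)] [cite: CremonaAlgorithms1997, Table 1 (718b1)] -/
theorem kolyvaginPrime_iff_twistKuriharaBit_13_neg7
    (h372 : GrossLMS1991.prop37_2_frobeniusCongruence)
    (h84 : Literature.NumberTheory.EllipticCurves.WZhang2014_lemma84_exists_minimal_kolyvaginClass_one_selmerCard)
    (hKim : Kim2022_card_selmerGroup_le_pow_of_kuriharaNumber_ne_zero)
    (hSak1 : Sakamoto2022_card_selmerGroup_eq_pow_of_isDeltaMinimal)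
    (hSak2 : Sakamoto2022_exists_cyclicLevel_kuriharaNumber_ne_zero)
    (hnf : exists_isNewformOf) (hMaz : mazur_not_dvd_maninConstant_of_odd)
    (K : Type) [Field K] [NumberField K] (hK : IsImaginaryQuadratic K) (hD : NumberField.discr K = -7)
    (hδE : haveI := isElliptic_c718b1; haveI := isGloballyMinimal_c718b1;
      haveI : NeZero (((⟨1, 0, 1, -5, 0⟩ : WeierstrassCurve ℤ).map (Int.castRingHom ℚ)).conductorNorm ℤ) := neZero_conductorNorm_of_isElliptic _;
      haveI := Fact.mk (by norm_num : Nat.Prime 13);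
      ∀ (D : ModularParametrizationData ((⟨1, 0, 1, -5, 0⟩ : WeierstrassCurve ℤ).map (Int.castRingHom ℚ)) (((⟨1, 0, 1, -5, 0⟩ : WeierstrassCurve ℤ).map (Int.castRingHom ℚ)).conductorNorm ℤ)), ¬ ((13 : ℕ) : ℤ) ∣ D.maninConstant →
        (∃ u : ℚ, ‖(u : ℚ_[13])‖ = 1 ∧ ((⟨1, 0, 1, -5, 0⟩ : WeierstrassCurve ℤ).map (Int.castRingHom ℚ)).realPeriodRat = u * plusPeriod D.f) →
        ∃ ψ : (ℓ : ℕ) → (ZMod ℓ)ˣ →* Multiplicative (ZMod 13),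
          (∀ ℓ ∈ (1682617 : ℕ).primeFactors, Function.Surjective (ψ ℓ)) ∧ kuriharaNumber D.f 13 1682617 ψ ≠ 0) :
    haveI := isElliptic_c718b1; haveI := isGloballyMinimal_c718b1;
    haveI : NeZero (((⟨1, 0, 1, -5, 0⟩ : WeierstrassCurve ℤ).map (Int.castRingHom ℚ)).conductorNorm ℤ) := neZero_conductorNorm_of_isElliptic _;
    haveI := minTwist7_isElliptic; haveI := minTwist7_isGloballyMinimal;
    haveI : NeZero (((⟨1, 1, 0, -221, -307⟩ : WeierstrassCurve ℤ).map (Int.castRingHom ℚ)).conductorNorm ℤ) := neZero_conductorNorm_of_isElliptic _;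
    haveI := Fact.mk (by norm_num : Nat.Prime 13);
    (∃ (Dt : ModularParametrizationData ((⟨1, 0, 1, -5, 0⟩ : WeierstrassCurve ℤ).map (Int.castRingHom ℚ)) (((⟨1, 0, 1, -5, 0⟩ : WeierstrassCurve ℤ).map (Int.castRingHom ℚ)).conductorNorm ℤ)) (β : ℤ)
      (ι : K →+* ℂ) (ℓ : ℕ) (d : KolyvaginHeegnerData Dt β ι ℓ),
      ℓ.Prime ∧ Zhang2014.IsKolyvaginPrime (((⟨1, 0, 1, -5, 0⟩ : WeierstrassCurve ℤ).map (Int.castRingHom ℚ)).conductorNorm ℤ) ((⟨1, 0, 1, -5, 0⟩ : WeierstrassCurve ℤ).map (Int.castRingHom ℚ)) K 13 ℓ ∧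
        d.kolyvaginClass (p := 13) (by norm_num) 1 ≠ 0) ↔
    (∀ (D : ModularParametrizationData ((⟨1, 1, 0, -221, -307⟩ : WeierstrassCurve ℤ).map (Int.castRingHom ℚ))
          (((⟨1, 1, 0, -221, -307⟩ : WeierstrassCurve ℤ).map (Int.castRingHom ℚ)).conductorNorm ℤ)),
        ¬ ((13 : ℕ) : ℤ) ∣ D.maninConstant →
        (∃ u : ℚ, ‖(u : ℚ_[13])‖ = 1 ∧
          ((⟨1, 1, 0, -221, -307⟩ : WeierstrassCurve ℤ).map (Int.castRingHom ℚ)).realPeriodRat = u * plusPeriod D.f) →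
        ∃ (m : ℕ) (_ : NeZero m), IsCyclicKolyvaginLevel ((⟨1, 1, 0, -221, -307⟩ : WeierstrassCurve ℤ).map (Int.castRingHom ℚ)) 13 m ∧
          m.primeFactors.card ≤ 1 ∧
          ∃ ψ : (ℓ : ℕ) → (ZMod ℓ)ˣ →* Multiplicative (ZMod 13),
            (∀ ℓ ∈ m.primeFactors, Function.Surjective (ψ ℓ)) ∧ kuriharaNumber D.f 13 m ψ ≠ 0) := by
  haveI := isElliptic_c718b1
  haveI := isGloballyMinimal_c718b1
  haveI iNZ : NeZero (((⟨1, 0, 1, -5, 0⟩ : WeierstrassCurve ℤ).map (Int.castRingHom ℚ)).conductorNorm ℤ) :=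
    neZero_conductorNorm_of_isElliptic _
  haveI := minTwist7_isElliptic
  haveI := minTwist7_isGloballyMinimal
  haveI iNZT : NeZero (((⟨1, 1, 0, -221, -307⟩ : WeierstrassCurve ℤ).map (Int.castRingHom ℚ)).conductorNorm ℤ) :=
    neZero_conductorNorm_of_isElliptic _
  haveI iP := Fact.mk (by norm_num : Nat.Prime 13)
  have hsha := sha_inf_torsionBy_eq_bot_of_kuriharaClaim_13 hKim hnf hMaz hδE
  have hsur : ((⟨1, 0, 1, -5, 0⟩ : WeierstrassCurve ℤ).map (Int.castRingHom ℚ)).HasSurjectiveModNGaloisRep ((13 : ℕ) : ℤ) := by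
    simpa using hasSurjectiveModNGaloisRep_13
  have htower : ∀ k : ℕ, ((⟨1, 0, 1, -5, 0⟩ : WeierstrassCurve ℤ).map (Int.castRingHom ℚ)).HasSurjectiveModNGaloisRep ((13 : ℕ) ^ k : ℕ) :=
    serre_hasSurjectiveModNGaloisRep_pow_holds _ 13 (by norm_num) hsur
  have hsp := spadeOne_of_five_le 13 (by norm_num)
  have hS2 : ¬ Squarefree (((⟨1, 0, 1, -5, 0⟩ : WeierstrassCurve ℤ).map (Int.castRingHom ℚ)).conductorNorm ℤ) →
      (∃ (ℓ : ℕ) (_ : Fact ℓ.Prime), ((⟨1, 0, 1, -5, 0⟩ : WeierstrassCurve ℤ).map (Int.castRingHom ℚ)).HasMultiplicativeReductionAtPrime ℓ ∧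
          ¬ 13 ∣ padicValInt ℓ ((⟨1, 0, 1, -5, 0⟩ : WeierstrassCurve ℤ).map (Int.castRingHom ℚ)).minimalDiscriminantInt) ∧
        ∃ (ℓ₁ ℓ₂ : ℕ) (_ : Fact ℓ₁.Prime) (_ : Fact ℓ₂.Prime), ℓ₁ ≠ ℓ₂ ∧
          ((⟨1, 0, 1, -5, 0⟩ : WeierstrassCurve ℤ).map (Int.castRingHom ℚ)).HasMultiplicativeReductionAtPrime ℓ₁ ∧
          ((⟨1, 0, 1, -5, 0⟩ : WeierstrassCurve ℤ).map (Int.castRingHom ℚ)).HasMultiplicativeReductionAtPrime ℓ₂ :=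
    fun hns ↦ absurd ((((⟨1, 0, 1, -5, 0⟩ : WeierstrassCurve ℤ).map (Int.castRingHom ℚ))).isSemistable_iff_squarefree_conductorNorm.mp hsp.2) hns
  have hH := satisfiesHeegnerHypothesis_conductorNorm_of_intModel intModel K hK.1 hD heegner_neg7
  have hD3 : NumberField.discr K ≠ -3 := by rw [hD]; norm_num
  have hD4 : NumberField.discr K ≠ -4 := by rw [hD]; norm_num
  have hpD : ¬ (((13 : ℕ) : ℤ) ∣ NumberField.discr K) := by rw [hD]; decide
  have hC : (⟨1, (-1 : ℚ), -((1 : ℚ) / 2), (1 : ℚ) / 2⟩ : WeierstrassCurve.VariableChange ℚ) •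
      ((⟨1, 1, 0, -221, -307⟩ : WeierstrassCurve ℤ).map (Int.castRingHom ℚ)) =
      ((⟨1, 0, 1, -5, 0⟩ : WeierstrassCurve ℤ).map (Int.castRingHom ℚ)).quadraticTwist ((NumberField.discr K : ℤ) : ℚ) := by
    rw [hD]; push_cast; exact minTwist7_smul_eq
  have hr2 := Summit.BirchSwinnertonDyer.BirchSwinnertonDyer.Rank2Observatory.C718b1.mordellWeilRank_eq_two
  have hT := natCard_selmerGroup_quadraticTwist_le_iff_kuriharaBit hKim hSak1 hSak2 hnf hMaz _ 13 (by norm_num) goodOrdinary_13.1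
    goodOrdinary_13.2 hsur (NumberField.discr_ne_zero K) hpD _ _ hC minTwist7_nonAnomalous_13 (minTwist7_kodairaNeron_of_five_le 13 (by norm_num)) 1
  rw [pow_one] at hT
  rw [kolyvaginClass_prime_ne_zero_iff_shaTrivial_twistSelmer_of_rank_two_of_lemma84 h372 h84 _ not_hasCM 13 (by norm_num)
    goodOrdinary_13.1 goodOrdinary_13.2 htower (kodairaNeron_of_five_le 13 (by norm_num)) hsp.1 hS2 K hK hD3 hD4 hpD hH hr2,
    and_iff_right hsha]
  exact hT

end C718b1

end Summit.BirchSwinnertonDyer.BirchSwinnertonDyer.Theorems.KolyvaginDepthDoor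

end
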